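import Mathlib
import Literature.MathematicalPhysics.QuantumFieldTheory.Balaban1983to89.B6FrameReduction
import Literature.MathematicalPhysics.QuantumFieldTheory.Balaban1983to89.B6BondElimination

/-!
# `Balaban1983to89.B6FrameEngineScope` — SCOPE CERTIFICATE for the frame abstraction of `…B6FrameReduction`:
the metric axioms of a `Frame` do NOT imply an `Engine` (kernel form of cell GAPS G-A19-1)

B6 = T. Bałaban, *Propagators and renormalization transformations for lattice gauge theories. II*, Commun. Math.
Phys. **96**, 223–250 (1984) [Balaban1984PropagatorsII]; [3] = B4 = T. Bałaban, *Regularity and decay of lattice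
Green's functions*, Commun. Math. Phys. **89**, 571–597 (1983) [Balaban1983RegularityDecay].

THE PRINTED STATEMENTS THIS FILE IS ABOUT (verbatim; B4 p. 594 read this session from the ×2 render
`run/shared/lean/pub/pub-balaban/b2b-balaban-ref1/pages/1983-cmp89-regularity-decay/…-p024-x2.png`, journal page =
PDF page + 570; B6 p. 242 as quoted and cross-read in `…B6FrameReduction`, cell GAPS C-A19-1):
* [3], Sect. 5 Theorem p. 594: *"Let Ω ⊂ Z^d and let A be a symmetric operator defined on the space L²(Ω) of
  functions φ: Ω → R^N and satisfying the following condition: there exist positive constants γ₀, c₀, δ₀ such that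
  A ≥ γ₀I, |A(x, x′)| ≤ c₀e^{−δ₀|x−x′|}, x, x′ ∈ Ω. (5.6)  Then there exist positive constants c₁, δ₁ such that for
  arbitrary Λ ⊂ Ω and for C_Λ = A_Λ⁻¹, A_Λ is an operator defined on L²(Λ) by A_Λ = ΛAΛ. We have
  |C_Λ(x, x′)| ≤ c₁e^{−δ₁|x−x′|}, x, x′ ∈ Λ, (5.7)"*.
* B6 p. 242 [PDF 20] (S2): *"From the theorem on unit lattice operators in [3] it follows that a covariance
  C′^{(j)}_Λ of the last Gaussian integrals in (2.106) is a bounded operator with an exponential decay independent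
  of j and Λ"* — used in B6 on the tori T^{(k)}_□ and their sub-lattices (pp. 242, 246, 249–250).

CITATION HEADER (lean-in-tree rule 2026-08-18).  Cell `pub-balaban`, unit `b2b-balaban-pv09-g4` (SURGE NODE PROVER
#09, gen 4; journal claim G-A19-1-KERNEL; cell GAPS row C-pv09g4-5).  Sibling of `…B6FrameReduction` (unit b06-g4,
v1.1: `Frame`, `Hyp56`, `InvDecay`, `Engine`, `engine_of_profile`), of `…B4Sect5Torus` (this unit: the Sect. 5
Theorem of [3] over an arbitrary finite index set with a pseudo-distance AND a lattice-sum profile,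
`sect5Uniform_holds`), and of `…B6Sect5Torus` / `…B6BondEliminationTorus` (this unit: the torus and periodic
classes, each WITH its profile, hence with an engine).  Used BY NAME: `B6FrameReduction.Frame/Hyp56/InvDecay/Engine`,
`B6BondElimination.isUnit_det_of_lower`.  Nothing landed is edited or restated.

## What the papers say, what `…B6FrameReduction` abstracts, and what is certified here

[3] states its theorem for Ω ⊂ ℤ^d; B6 uses it on tori and sub-lattices; both are honest metric spaces with a
lattice growth bound.  `…B6FrameReduction` types the USE-SITE SCHEME of B6 over an arbitrary FRAME (a site type
with a bare pseudo-metric ρ: ρ(x,x) = 0, symmetry, triangle inequality — `Frame`) and takes the theorem of [3] as a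
hypothesis `Engine N 𝒞` on a CLASS 𝒞 of (frame, region) pairs: for all positive (γ₀, c₀, δ₀) there are positive
(c₁, δ₁) serving every member.  Its v1.1 docstrings WARN — after the adversarial cross-read of unit adv1-g14 (cell
GAPS G-A19-1: a numerical witness reproduced by four independent engines, best decay rate ≈ 1.3/√n → 0) — that an
engine is a hypothesis PER CLASS and NOT a consequence of the frame axioms; what an engine needs is a UNIFORM
lattice-sum profile of the class (`engine_of_profile`).  THIS FILE PROVES THAT WARNING IN THE KERNEL, with an
exact rational witness:

`not_engine : ∀ N ≥ 1, ¬ Engine N chainClass`.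

THE WITNESS.  Frames `chain D m` (§3): sites {0,…,D} × Fin m with ρ((k,i),(k′,i′)) = |k − k′| — a PSEUDO-metric
putting the m copies of a position at mutual distance 0 (allowed by `Frame`; the only feature exploited).
Operators A = I + 2·(I − ½adj) ⊗ J_m ⊗ I_N (`opA`; J_m = all-ones): (5.6)_ρ holds with (γ₀, c₀, δ₀) = (1, 3, 1)
for EVERY D, m, N (`hyp56_opA`: symmetric; A ≥ 1 because I − ½adj ≥ 0 on the chain by weak diagonal dominance —
every position has at most one successor and one predecessor, §2 — and J_m = 𝟙𝟙ᵀ ≥ 0, via the fibre identity of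
§1; entries 3 (diagonal), 2 (distance 0), −1 (distance 1), 0 otherwise).  For m = q(q+1) the reduced ("top
sector") tridiagonal system (2m+1)x_k − m(x_{k−1} + x_{k+1}) = δ has the RATIONAL characteristic roots
ν = (q+1)/q and λ = q/(q+1) (`root_nu`, `root_lam`), so the inverse column of A with source at the end D is
explicit (§§4–5: `xf`, `col`, `opA_mulVec_col`; A⁻¹(p, source) = col p by `isUnit_det_of_lower`, `inv_entry`), and
the end-to-end entry is (ν − λ)/(m²(ν^{D+2} − λ^{D+2})) ≥ 1/(m³ν^{D+2}) > 0.  Given (c₁, δ₁), take q = ⌈1/δ₁⌉ (so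
ν = 1 + 1/q < e^{1/q} ≤ e^{δ₁}) and D with (e^{δ₁}/ν)^D > c₁m³ν² (Archimedes): (5.7)_ρ fails between the two ends
(§6).  Relation to adv1-g14's numerical witness ({−n,…,n} × Fin n, A_n = I + 2(1 + ½adj) ⊗ J_n, closed form
1/(2n² cosh((n+1)θ_n))): the same mechanism (zero-distance multiplicity drives the top sector to the critical
coupling); this variant flips the sign of the hopping (an M-matrix top sector) and ties m = q(q+1) so that the
recurrence roots are rational — the kernel proof is then pure algebra plus 1 + x < e^x and Archimedes' axiom.

CONSEQUENCES (scope; unchanged from G-A19-1, now kernel-checked): (i) every consumer of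
`B6FrameReduction.reductions_uniform` must supply an engine for ITS class; in the tree this is done for {ℤ^d}
(`engine_zd`), the tori (`…B6Sect5Torus`), the periodic frames (`…B6BondEliminationTorus.engine_per`) and every class
with a uniform profile (`engine_of_profile`, `engine_of_profileBound`); the chains here have the m-dependent profile
m·Σ_k e^{−a|k|}, unbounded over the class — consistent with, and showing the necessity of, the profile hypothesis.
(ii) NO statement of [3] or of B6 is disputed: both concern honest lattices; the theorem delimits OUR abstraction only.

## What this file does NOT claim
Nothing about the operators of the papers; not that `Frame` should carry more axioms (the profile is supplied per
class, which is how the tree uses it); N = 0 is excluded (the index set is empty and an engine is vacuous there).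
Value = a kernel-checked NEGATIVE bookkeeping node fixing the scope of an abstraction consumed by three tree modules;
NOT summit progress.
-/

open Finset Matrix

namespace Literature.MathematicalPhysics.QuantumFieldTheory.Balaban1983to89.B6FrameEngineScope

open B6FrameReduction (Frame Hyp56 InvDecay Engine)

noncomputable section

/-! ## §1  Grouping the indices of a bilinear form by a key -/

/-- Σ_q h(key q)·v_q = Σ_g h(g)·S_g with the fibre sums S_g = Σ_{key q = g} v_q. [folklore] -/
theorem key_sum {ι κ : Type*} [Fintype ι] [Fintype κ] [DecidableEq κ] (key : ι → κ) (v : ι → ℝ)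
    (h : κ → ℝ) : ∑ q, h (key q) * v q = ∑ g, h g * ∑ q, (if key q = g then v q else 0) := by
  have hq : ∀ q, ∑ g, h g * (if key q = g then v q else 0) = h (key q) * v q := fun q => by
    simp_rw [mul_ite, mul_zero]
    rw [Finset.sum_ite_eq]
    simp
  simp_rw [Finset.mul_sum]
  rw [Finset.sum_comm]
  exact Finset.sum_congr rfl fun q _ => (hq q).symm

/-- A bilinear form whose kernel depends on the indices only through a key is the same form in the fibre sums:
Σ_{p,q} f(key p, key q) v_p v_q = Σ_{g,g′} f(g,g′) S_g S_{g′}. [folklore] -/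
theorem biform_key {ι κ : Type*} [Fintype ι] [Fintype κ] [DecidableEq κ] (key : ι → κ) (f : κ → κ → ℝ)
    (v : ι → ℝ) :
    ∑ p, ∑ q, f (key p) (key q) * v p * v q =
      ∑ g, ∑ g', f g g' * (∑ p, if key p = g then v p else 0) * (∑ q, if key q = g' then v q else 0) := by
  set S : κ → ℝ := fun g => ∑ p, if key p = g then v p else 0 with hS
  calc ∑ p, ∑ q, f (key p) (key q) * v p * v q
      = ∑ p, v p * ∑ q, f (key p) (key q) * v q := by
        refine Finset.sum_congr rfl fun p _ => ?_
        rw [Finset.mul_sum]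
        exact Finset.sum_congr rfl fun q _ => by ring
    _ = ∑ p, v p * ∑ g', f (key p) g' * S g' := by
        refine Finset.sum_congr rfl fun p _ => ?_
        rw [key_sum key v (fun g' => f (key p) g')]
    _ = ∑ g', S g' * ∑ p, f (key p) g' * v p := by
        simp_rw [Finset.mul_sum]
        rw [Finset.sum_comm]
        exact Finset.sum_congr rfl fun g' _ => Finset.sum_congr rfl fun p _ => by ring
    _ = ∑ g', S g' * ∑ g, f g g' * S g := by
        refine Finset.sum_congr rfl fun g' _ => ?_
        rw [key_sum key v (fun g => f g g')]
    _ = ∑ g, ∑ g', f g g' * S g * S g' := by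
        simp_rw [Finset.mul_sum]
        rw [Finset.sum_comm]
        exact Finset.sum_congr rfl fun g _ => Finset.sum_congr rfl fun g' _ => by ring

/-! ## §2  The chain {0,…,D}: successor indicator, adjacency, the position operator b = I − ½·adj -/

variable (D : ℕ)

/-- successor indicator on positions {0,…,D}: [k′ = k + 1]. [folklore] -/
def succInd (k k' : Fin (D + 1)) : ℝ := if (k' : ℕ) = (k : ℕ) + 1 then 1 else 0

/-- the successor indicator is nonnegative. [folklore] -/
theorem succInd_nonneg (k k' : Fin (D + 1)) : 0 ≤ succInd D k k' := by
  unfold succInd; split_ifs <;> norm_num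

/-- every position has at most one successor. [folklore] -/
theorem sum_succInd_right_le (k : Fin (D + 1)) : ∑ k', succInd D k k' ≤ 1 := by
  unfold succInd
  rw [Finset.sum_boole]
  have : (Finset.univ.filter fun k' : Fin (D + 1) => (k' : ℕ) = (k : ℕ) + 1).card ≤ 1 :=
    Finset.card_le_one.mpr fun a ha b hb => by
      simp only [Finset.mem_filter, Finset.mem_univ, true_and] at ha hb
      exact Fin.ext (by omega)
  exact_mod_cast this

/-- every position has at most one predecessor. [folklore] -/
theorem sum_succInd_left_le (k' : Fin (D + 1)) : ∑ k, succInd D k k' ≤ 1 := by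
  unfold succInd
  rw [Finset.sum_boole]
  have : (Finset.univ.filter fun k : Fin (D + 1) => (k' : ℕ) = (k : ℕ) + 1).card ≤ 1 :=
    Finset.card_le_one.mpr fun a ha b hb => by
      simp only [Finset.mem_filter, Finset.mem_univ, true_and] at ha hb
      exact Fin.ext (by omega)
  exact_mod_cast this

/-- adjacency of the chain: [|k − k′| = 1] = [k′ = k+1] + [k = k′+1]. [folklore] -/
def adj (k k' : Fin (D + 1)) : ℝ := succInd D k k' + succInd D k' k

/-- the position operator b = I − ½·adj (weakly diagonally dominant, hence b ≥ 0). [folklore] -/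
def bpos (k k' : Fin (D + 1)) : ℝ := (if k = k' then 1 else 0) - adj D k k' / 2

/-- Σ_{k,k′} [k′ = k+1] s_k s_{k′} ≤ Σ_k s_k² (AM–GM and at most one successor / predecessor). [folklore] -/
theorem succ_form_le (s : Fin (D + 1) → ℝ) :
    ∑ k, ∑ k', succInd D k k' * s k * s k' ≤ ∑ k, s k ^ 2 := by
  have h1 : ∑ k, ∑ k', succInd D k k' * s k * s k'
      ≤ ∑ k, ∑ k', (succInd D k k' * s k ^ 2 / 2 + succInd D k k' * s k' ^ 2 / 2) :=
    Finset.sum_le_sum fun k _ => Finset.sum_le_sum fun k' _ => by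
      have h0 := succInd_nonneg D k k'
      nlinarith [mul_nonneg h0 (sq_nonneg (s k - s k'))]
  have hA : ∀ k, ∑ k', succInd D k k' * s k ^ 2 / 2 = (s k ^ 2 / 2) * ∑ k', succInd D k k' :=
    fun k => by rw [Finset.mul_sum]; exact Finset.sum_congr rfl fun k' _ => by ring
  have hB : ∀ k', ∑ k, succInd D k k' * s k' ^ 2 / 2 = (s k' ^ 2 / 2) * ∑ k, succInd D k k' :=
    fun k' => by rw [Finset.mul_sum]; exact Finset.sum_congr rfl fun k _ => by ring
  calc ∑ k, ∑ k', succInd D k k' * s k * s k'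
      ≤ ∑ k, ∑ k', (succInd D k k' * s k ^ 2 / 2 + succInd D k k' * s k' ^ 2 / 2) := h1
    _ = ∑ k, ∑ k', succInd D k k' * s k ^ 2 / 2 + ∑ k, ∑ k', succInd D k k' * s k' ^ 2 / 2 := by
        rw [← Finset.sum_add_distrib]
        exact Finset.sum_congr rfl fun k _ => Finset.sum_add_distrib
    _ = ∑ k, (s k ^ 2 / 2) * ∑ k', succInd D k k' + ∑ k', (s k' ^ 2 / 2) * ∑ k, succInd D k k' := by
        congr 1
        · exact Finset.sum_congr rfl fun k _ => hA k
        · rw [Finset.sum_comm]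
          exact Finset.sum_congr rfl fun k' _ => hB k'
    _ ≤ ∑ k, (s k ^ 2 / 2) * 1 + ∑ k', (s k' ^ 2 / 2) * 1 :=
        add_le_add
          (Finset.sum_le_sum fun k _ =>
            mul_le_mul_of_nonneg_left (sum_succInd_right_le D k) (by positivity))
          (Finset.sum_le_sum fun k' _ =>
            mul_le_mul_of_nonneg_left (sum_succInd_left_le D k') (by positivity))
    _ = ∑ k, s k ^ 2 := by
        rw [← Finset.sum_add_distrib]
        exact Finset.sum_congr rfl fun k _ => by ring

/-- b = I − ½·adj is positive semi-definite on the chain. [folklore] -/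
theorem bform_nonneg (s : Fin (D + 1) → ℝ) : 0 ≤ ∑ k, ∑ k', bpos D k k' * s k * s k' := by
  have hpt : ∀ k k', bpos D k k' * s k * s k' = (if k = k' then s k * s k' else 0)
      - succInd D k k' * s k * s k' / 2 - succInd D k' k * s k' * s k / 2 := by
    intro k k'; unfold bpos adj; split_ifs <;> ring
  simp_rw [hpt, Finset.sum_sub_distrib]
  have h1 : ∑ k : Fin (D + 1), ∑ k', (if k = k' then s k * s k' else 0) = ∑ k, s k ^ 2 := by
    refine Finset.sum_congr rfl fun k _ => ?_
    rw [Finset.sum_ite_eq]; simp [sq]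
  have h2 : ∑ k : Fin (D + 1), ∑ k', succInd D k k' * s k * s k' / 2 ≤ (∑ k, s k ^ 2) / 2 := by
    have := succ_form_le D s
    simp_rw [← Finset.sum_div]
    linarith
  have h3 : ∑ k : Fin (D + 1), ∑ k', succInd D k' k * s k' * s k / 2 ≤ (∑ k, s k ^ 2) / 2 := by
    rw [Finset.sum_comm]
    have := succ_form_le D s
    simp_rw [← Finset.sum_div]
    linarith
  linarith [h1, h2, h3]

/-! ## §3  The frames: chains with m zero-distance copies of each position; the operators A = I + 2·b ⊗ J_m ⊗ I_N -/

variable (m : ℕ)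

/-- sites: (position k ∈ {0,…,D}) × (copy i ∈ Fin m). [folklore] -/
abbrev Site (D m : ℕ) : Type := Fin (D + 1) × Fin m

/-- the pseudo-distance |k − k′| (the m copies of a position are at mutual distance 0). [folklore] -/
def cdist (x y : Site D m) : ℝ := |((x.1 : ℕ) : ℝ) - ((y.1 : ℕ) : ℝ)|

/-- the CHAIN FRAME: a `Frame` in the sense of `…B6FrameReduction` (all three axioms hold). [folklore] -/
abbrev chain (D m : ℕ) : Frame where
  S := Site D m
  ρ := cdist D m
  ρ_self x := by simp [cdist]
  ρ_comm x y := abs_sub_comm _ _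
  ρ_triangle x y z := abs_sub_le _ _ _

/-- the site operator a = I + 2·(b ⊗ J_m): entries 3 (diagonal), 2 (two copies of one position), −1 (adjacent
positions), 0 otherwise. [folklore] -/
def aSite (x y : Site D m) : ℝ := (if x = y then 1 else 0) + 2 * bpos D x.1 y.1

variable (N : ℕ)

/-- the operator on the N-component index set of the whole chain: A = a ⊗ I_N. [folklore] -/
def opA : Matrix ((chain D m).Idx Finset.univ N) ((chain D m).Idx Finset.univ N) ℝ :=
  fun p q => if p.2 = q.2 then aSite D m p.1.1 q.1.1 else 0

/-- a is symmetric. [folklore] -/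
theorem aSite_comm (x y : Site D m) : aSite D m x y = aSite D m y x := by
  unfold aSite bpos adj
  rw [add_comm (succInd D x.1 y.1) (succInd D y.1 x.1),
    if_congr (@eq_comm _ x y) rfl rfl, if_congr (@eq_comm _ x.1 y.1) rfl rfl]

/-- (5.6), symmetry part, for A over the chain frame. [folklore] -/
theorem opA_isSymm : (opA D m N).IsSymm :=
  Matrix.IsSymm.ext fun p q => by
    unfold opA
    rw [if_congr (@eq_comm _ q.2 p.2) (aSite_comm D m q.1.1 p.1.1) rfl]

/-- e ≤ 3, in the form used for the nearest-neighbour entries. [folklore] -/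
theorem one_le_three_exp_neg_one : (1 : ℝ) ≤ 3 * Real.exp (-(1 * 1)) := by
  have he : Real.exp 1 < 3 := lt_trans Real.exp_one_lt_d9 (by norm_num)
  have hprod : Real.exp 1 * Real.exp (-(1 * 1)) = 1 := by
    rw [← Real.exp_add]; norm_num
  nlinarith [Real.exp_pos (-(1 * 1) : ℝ), hprod, he]

/-- the entries of a: |a(x,y)| ≤ 3·e^{−|k − k′|}. [folklore] -/
theorem aSite_decay (x y : Site D m) : |aSite D m x y| ≤ 3 * Real.exp (-(1 * cdist D m x y)) := by
  unfold aSite bpos adj cdist succInd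
  by_cases h1 : x.1 = y.1
  · have hd : |((x.1 : ℕ) : ℝ) - ((y.1 : ℕ) : ℝ)| = 0 := by rw [h1, sub_self, abs_zero]
    rw [hd, mul_zero, neg_zero, Real.exp_zero, mul_one]
    have hs : ¬ ((y.1 : ℕ) = (x.1 : ℕ) + 1) := by rw [h1]; omega
    have hs' : ¬ ((x.1 : ℕ) = (y.1 : ℕ) + 1) := by rw [h1]; omega
    rw [if_neg hs, if_neg hs', if_pos h1]
    split_ifs <;> norm_num
  · have hxy : x ≠ y := fun h => h1 (h ▸ rfl)
    rw [if_neg hxy, if_neg h1]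
    by_cases hs : (y.1 : ℕ) = (x.1 : ℕ) + 1
    · have hs' : ¬ ((x.1 : ℕ) = (y.1 : ℕ) + 1) := by omega
      rw [if_pos hs, if_neg hs']
      have hd : |((x.1 : ℕ) : ℝ) - ((y.1 : ℕ) : ℝ)| = 1 := by
        rw [hs]; push_cast; rw [show ((x.1 : ℕ) : ℝ) - ((x.1 : ℕ) + 1) = -1 by ring, abs_neg, abs_one]
      rw [hd]
      have := one_le_three_exp_neg_one
      rw [show |(0 : ℝ) + 2 * (0 - (1 + 0) / 2)| = 1 by norm_num]
      exact this
    · by_cases hs' : (x.1 : ℕ) = (y.1 : ℕ) + 1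
      · rw [if_neg hs, if_pos hs']
        have hd : |((x.1 : ℕ) : ℝ) - ((y.1 : ℕ) : ℝ)| = 1 := by
          rw [hs']; push_cast; rw [show ((y.1 : ℕ) : ℝ) + 1 - ((y.1 : ℕ) : ℝ) = 1 by ring, abs_one]
        rw [hd]
        have := one_le_three_exp_neg_one
        rw [show |(0 : ℝ) + 2 * (0 - (0 + 1) / 2)| = 1 by norm_num]
        exact this
      · rw [if_neg hs, if_neg hs']
        norm_num
        positivity

/-- (5.6), decay part, for A over the chain frame at (c₀, δ₀) = (3, 1). [folklore] -/
theorem opA_decay (p q : (chain D m).Idx Finset.univ N) :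
    |opA D m N p q| ≤ 3 * Real.exp (-(1 * (chain D m).ρ (p.1 : (chain D m).S) (q.1 : (chain D m).S))) := by
  show |opA D m N p q| ≤ 3 * Real.exp (-(1 * cdist D m p.1.1 q.1.1))
  unfold opA
  split_ifs with hc
  · exact aSite_decay D m p.1.1 q.1.1
  · rw [abs_zero]; positivity

/-- (5.6), lower bound, for A over the chain frame: A ≥ 1 (A = I + 2·b ⊗ J_m ⊗ I_N with b ≥ 0). [folklore] -/
theorem opA_lower (v : (chain D m).Idx Finset.univ N → ℝ) :
    1 * ∑ p, v p ^ 2 ≤ ∑ p, v p * (opA D m N *ᵥ v) p := by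
  let key : (chain D m).Idx Finset.univ N → Fin N × Fin (D + 1) := fun p => (p.2, p.1.1.1)
  let f : Fin N × Fin (D + 1) → Fin N × Fin (D + 1) → ℝ :=
    fun g g' => if g.1 = g'.1 then bpos D g.2 g'.2 else 0
  have hA : ∀ p q, opA D m N p q = (if p = q then 1 else 0) + 2 * f (key p) (key q) := by
    intro p q
    show (if p.2 = q.2 then aSite D m p.1.1 q.1.1 else 0)
      = (if p = q then 1 else 0) + 2 * (if p.2 = q.2 then bpos D p.1.1.1 q.1.1.1 else 0)
    unfold aSite
    by_cases hc : p.2 = q.2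
    · rw [if_pos hc, if_pos hc]
      by_cases hpq : p = q
      · subst hpq; simp
      · have : p.1.1 ≠ q.1.1 := fun h => hpq (Prod.ext (Subtype.ext h) hc)
        rw [if_neg this, if_neg hpq]
    · have hpq : p ≠ q := fun h => hc (h ▸ rfl)
      rw [if_neg hc, if_neg hpq, if_neg hc]; ring
  have hQ : 0 ≤ ∑ p, ∑ q, f (key p) (key q) * v p * v q := by
    rw [biform_key key f v]
    set S : Fin N × Fin (D + 1) → ℝ := fun g => ∑ p, if key p = g then v p else 0 with hS
    rw [Fintype.sum_prod_type]
    refine Finset.sum_nonneg fun c _ => ?_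
    have hin : ∀ k, ∑ g', f (c, k) g' * S (c, k) * S g' = ∑ k', bpos D k k' * S (c, k) * S (c, k') := by
      intro k
      rw [Fintype.sum_prod_type]
      show ∑ c', ∑ k', (if c = c' then bpos D k k' else 0) * S (c, k) * S (c', k') = _
      simp_rw [ite_mul, zero_mul]
      rw [Finset.sum_comm]
      refine Finset.sum_congr rfl fun k' _ => ?_
      rw [Finset.sum_ite_eq]; simp
    rw [Finset.sum_congr rfl fun k _ => hin k]
    have := bform_nonneg D (fun k => S (c, k))
    simpa [mul_comm, mul_assoc, mul_left_comm] using this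
  have hexp : ∑ p, v p * (opA D m N *ᵥ v) p
      = ∑ p, v p ^ 2 + 2 * ∑ p, ∑ q, f (key p) (key q) * v p * v q := by
    simp only [Matrix.mulVec, dotProduct]
    simp_rw [hA]
    have hp : ∀ p, v p * ∑ q, ((if p = q then (1 : ℝ) else 0) + 2 * f (key p) (key q)) * v q
        = v p ^ 2 + 2 * ∑ q, f (key p) (key q) * v p * v q := by
      intro p
      rw [Finset.mul_sum, Finset.mul_sum]
      calc ∑ q, v p * (((if p = q then (1 : ℝ) else 0) + 2 * f (key p) (key q)) * v q)
          = ∑ q, ((if p = q then v p * v q else 0) + 2 * (f (key p) (key q) * v p * v q)) :=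
            Finset.sum_congr rfl fun q _ => by split_ifs <;> ring
        _ = v p ^ 2 + ∑ q, 2 * (f (key p) (key q) * v p * v q) := by
            rw [Finset.sum_add_distrib, Finset.sum_ite_eq]; simp [sq]
    rw [Finset.sum_congr rfl fun p _ => hp p, Finset.sum_add_distrib, ← Finset.mul_sum]
  rw [hexp]
  linarith [hQ]

/-- (5.6) of [3] over the chain frame, at (γ₀, c₀, δ₀) = (1, 3, 1), for EVERY D, m, N. [cite: Balaban1983RegularityDecay, (5.6) p.594] -/
theorem hyp56_opA : Hyp56 (chain D m) Finset.univ (opA D m N) 1 3 1 :=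
  ⟨opA_isSymm D m N, opA_lower D m N, opA_decay D m N⟩

/-! ## §4  The exact inverse column for m = q(q+1): rational recurrence roots (q+1)/q and q/(q+1) -/

variable {D m N}

/-- multiplicity m = q(q+1). [folklore] -/
def mult (q : ℕ) : ℕ := q * (q + 1)

/-- the root ν = (q+1)/q = 1 + 1/q > 1. [folklore] -/
def nu (q : ℕ) : ℝ := ((q : ℝ) + 1) / q

/-- the root λ = q/(q+1) = ν⁻¹ < 1. [folklore] -/
def lam (q : ℕ) : ℝ := (q : ℝ) / ((q : ℝ) + 1)

/-- m = q(q+1) as a real number. [folklore] -/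
theorem mult_cast (q : ℕ) : ((mult q : ℕ) : ℝ) = (q : ℝ) * ((q : ℝ) + 1) := by
  unfold mult; push_cast; ring

/-- m = q(q+1) ≥ 1 for q ≥ 1. [folklore] -/
theorem mult_pos {q : ℕ} (hq : 1 ≤ q) : 0 < mult q := by
  unfold mult; exact Nat.mul_pos (by omega) (by omega)

/-- ν is a root of the characteristic equation m t² − (2m+1) t + m = 0. [folklore] -/
theorem root_nu {q : ℕ} (hq : 1 ≤ q) :
    (mult q : ℝ) * nu q ^ 2 = (2 * (mult q : ℝ) + 1) * nu q - mult q := by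
  rw [mult_cast]; unfold nu
  have hq' : (q : ℝ) ≠ 0 := Nat.cast_ne_zero.mpr (by omega)
  field_simp; ring

/-- λ is a root of the characteristic equation m t² − (2m+1) t + m = 0. [folklore] -/
theorem root_lam (q : ℕ) : (mult q : ℝ) * lam q ^ 2 = (2 * (mult q : ℝ) + 1) * lam q - mult q := by
  rw [mult_cast]; unfold lam
  have hq' : (q : ℝ) + 1 ≠ 0 := by positivity
  field_simp; ring

/-- the solution of the reduced (top-sector) tridiagonal system with source at position D:
x_n = (ν^n − λ^n)/(m(ν^{D+2} − λ^{D+2})) (index shifted by one: position k carries x_{k+1}, x_0 = 0). [folklore] -/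
def xf (q D : ℕ) (n : ℕ) : ℝ := (nu q ^ n - lam q ^ n) / ((mult q : ℝ) * (nu q ^ (D + 2) - lam q ^ (D + 2)))

/-- x_0 = 0 (the Dirichlet condition below position 0). [folklore] -/
theorem xf_zero (q D : ℕ) : xf q D 0 = 0 := by simp [xf]

/-- the three-term recurrence m x_{n+2} = (2m+1) x_{n+1} − m x_n. [folklore] -/
theorem xf_rec {q : ℕ} (hq : 1 ≤ q) (D n : ℕ) :
    (mult q : ℝ) * xf q D (n + 2) = (2 * (mult q : ℝ) + 1) * xf q D (n + 1) - (mult q : ℝ) * xf q D n := by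
  have key : (mult q : ℝ) * (nu q ^ (n + 2) - lam q ^ (n + 2))
      = (2 * (mult q : ℝ) + 1) * (nu q ^ (n + 1) - lam q ^ (n + 1)) - (mult q : ℝ) * (nu q ^ n - lam q ^ n) := by
    have h1 := root_nu hq
    have h2 := root_lam q
    calc (mult q : ℝ) * (nu q ^ (n + 2) - lam q ^ (n + 2))
        = nu q ^ n * ((mult q : ℝ) * nu q ^ 2) - lam q ^ n * ((mult q : ℝ) * lam q ^ 2) := by ring
      _ = nu q ^ n * ((2 * (mult q : ℝ) + 1) * nu q - mult q)
          - lam q ^ n * ((2 * (mult q : ℝ) + 1) * lam q - mult q) := by rw [h1, h2]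
      _ = _ := by ring
  unfold xf
  rw [mul_div_assoc', key, mul_div_assoc', mul_div_assoc', ← sub_div]

/-- ν > 1. [folklore] -/
theorem nu_gt_one {q : ℕ} (hq : 1 ≤ q) : 1 < nu q := by
  unfold nu
  have : (0 : ℝ) < q := by exact_mod_cast hq
  rw [one_lt_div this]; linarith

/-- λ > 0. [folklore] -/
theorem lam_pos {q : ℕ} (hq : 1 ≤ q) : 0 < lam q := by
  unfold lam
  have : (0 : ℝ) < q := by exact_mod_cast hq
  positivity

/-- λ < 1. [folklore] -/
theorem lam_lt_one (q : ℕ) : lam q < 1 := by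
  unfold lam
  rw [div_lt_one (by positivity)]; linarith

/-- ν^{D+2} − λ^{D+2} > 0. [folklore] -/
theorem gap_pos {q : ℕ} (hq : 1 ≤ q) (D : ℕ) : 0 < nu q ^ (D + 2) - lam q ^ (D + 2) :=
  sub_pos.mpr (pow_lt_pow_left₀ ((lam_lt_one q).trans (nu_gt_one hq)) (lam_pos hq).le (by omega))

/-- the normalisation m x_{D+2} = 1 (the source row). [folklore] -/
theorem xf_top {q : ℕ} (hq : 1 ≤ q) (D : ℕ) : (mult q : ℝ) * xf q D (D + 2) = 1 := by
  unfold xf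
  have h1 : (mult q : ℝ) ≠ 0 := Nat.cast_ne_zero.mpr (mult_pos hq).ne'
  have h2 : nu q ^ (D + 2) - lam q ^ (D + 2) ≠ 0 := (gap_pos hq D).ne'
  field_simp

/-- Σ_{k′} [k′ = k+1]·g(k′+1) = g(k+2) if k < D, else 0. [folklore] -/
theorem sum_succ_right (g : ℕ → ℝ) (k : Fin (D + 1)) :
    ∑ k' : Fin (D + 1), succInd D k k' * g ((k' : ℕ) + 1)
      = if (k : ℕ) < D then g ((k : ℕ) + 1 + 1) else 0 := by
  unfold succInd
  split_ifs with hk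
  · rw [Finset.sum_eq_single ⟨(k : ℕ) + 1, by omega⟩]
    · simp
    · intro k' _ hk'
      rw [if_neg (fun h => hk' (Fin.ext h)), zero_mul]
    · intro h; exact absurd (Finset.mem_univ _) h
  · refine Finset.sum_eq_zero fun k' _ => ?_
    have := k'.isLt
    rw [if_neg (by omega), zero_mul]

/-- Σ_{k′} [k = k′+1]·g(k′+1) = g(k) (for g(0) = 0). [folklore] -/
theorem sum_succ_left (g : ℕ → ℝ) (hg : g 0 = 0) (k : Fin (D + 1)) :
    ∑ k' : Fin (D + 1), succInd D k' k * g ((k' : ℕ) + 1) = g k := by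
  unfold succInd
  by_cases hk : (k : ℕ) = 0
  · rw [hk, hg]
    refine Finset.sum_eq_zero fun k' _ => ?_
    rw [if_neg (by omega), zero_mul]
  · rw [Finset.sum_eq_single ⟨(k : ℕ) - 1, by omega⟩]
    · have : ((k : ℕ) - 1 + 1) = (k : ℕ) := by omega
      simp only [this]; simp
    · intro k' _ hk'
      rw [if_neg, zero_mul]
      intro h; apply hk'; exact Fin.ext (by simp; omega)
    · intro h; exact absurd (Finset.mem_univ _) h

/-- the reduced tridiagonal system: (2m+1)x_{k+1} − m·Σ_{k′} adj(k,k′) x_{k′+1} = [k = D]. [folklore] -/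
theorem trow {q : ℕ} (hq : 1 ≤ q) (D : ℕ) (k : Fin (D + 1)) :
    (2 * (mult q : ℝ) + 1) * xf q D ((k : ℕ) + 1)
        - (mult q : ℝ) * ∑ k', adj D k k' * xf q D ((k' : ℕ) + 1)
      = if (k : ℕ) = D then 1 else 0 := by
  unfold adj
  simp_rw [add_mul, Finset.sum_add_distrib]
  rw [sum_succ_right (D := D) (xf q D) k, sum_succ_left (D := D) (xf q D) (xf_zero q D) k]
  have hrec := xf_rec hq D
  have hkD := k.isLt
  by_cases hk : (k : ℕ) < D
  · rw [if_pos hk, if_neg (by omega)]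
    linarith [hrec k]
  · have hk' : (k : ℕ) = D := by omega
    rw [if_neg hk, if_pos hk', zero_add]
    have h1 := hrec D
    have h2 := xf_top hq D
    rw [hk']
    linarith

/-! ## §5  The inverse column of A with source ((D, i₀), c₀) -/

/-- the site part of the column: x_{k+1}/m on every copy of position k, corrected at position D by the
zero-sum vector e_{i₀} − (1/m)·𝟙 (on which A acts as the identity). [folklore] -/
def uSite (q D : ℕ) (i₀ : Fin (mult q)) (x : Site D (mult q)) : ℝ :=
  xf q D ((x.1 : ℕ) + 1) / (mult q : ℝ)
    + if (x.1 : ℕ) = D then ((if x.2 = i₀ then 1 else 0) - 1 / (mult q : ℝ)) else 0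

/-- the column, supported on component c₀. [folklore] -/
def col (q D N : ℕ) (i₀ : Fin (mult q)) (c₀ : Fin N) : (chain D (mult q)).Idx Finset.univ N → ℝ :=
  fun p => if p.2 = c₀ then uSite q D i₀ p.1.1 else 0

/-- the copies of a position carry total weight x_{k+1}. [folklore] -/
theorem sum_uSite {q : ℕ} (hq : 1 ≤ q) (D : ℕ) (i₀ : Fin (mult q)) (k : Fin (D + 1)) :
    ∑ i : Fin (mult q), uSite q D i₀ (k, i) = xf q D ((k : ℕ) + 1) := by
  unfold uSite
  have hM : (mult q : ℝ) ≠ 0 := Nat.cast_ne_zero.mpr (mult_pos hq).ne'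
  dsimp only
  rw [Finset.sum_add_distrib, Finset.sum_const, Finset.card_univ, Fintype.card_fin, nsmul_eq_mul]
  by_cases hk : (k : ℕ) = D
  · simp only [hk, if_true]
    rw [Finset.sum_sub_distrib, Finset.sum_ite_eq', Finset.sum_const, Finset.card_univ, Fintype.card_fin,
      nsmul_eq_mul]
    simp only [Finset.mem_univ, if_true]
    field_simp
    ring
  · simp only [hk, if_false, Finset.sum_const_zero, add_zero]
    field_simp

/-- a·u = e_{(D, i₀)} on sites. [folklore] -/
theorem aSite_col {q : ℕ} (hq : 1 ≤ q) (D : ℕ) (i₀ : Fin (mult q)) (x : Site D (mult q)) :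
    ∑ y, aSite D (mult q) x y * uSite q D i₀ y = if x = (Fin.last D, i₀) then 1 else 0 := by
  have hM : (mult q : ℝ) ≠ 0 := Nat.cast_ne_zero.mpr (mult_pos hq).ne'
  unfold aSite
  simp_rw [add_mul]
  rw [Finset.sum_add_distrib]
  have h1 : ∑ y, (if x = y then (1 : ℝ) else 0) * uSite q D i₀ y = uSite q D i₀ x := by
    simp_rw [ite_mul, one_mul, zero_mul]; rw [Finset.sum_ite_eq]; simp
  have h2 : ∑ y : Site D (mult q), 2 * bpos D x.1 y.1 * uSite q D i₀ y
      = 2 * ∑ k', bpos D x.1 k' * xf q D ((k' : ℕ) + 1) := by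
    rw [Fintype.sum_prod_type, Finset.mul_sum]
    refine Finset.sum_congr rfl fun k' _ => ?_
    rw [← sum_uSite hq D i₀ k', Finset.mul_sum, Finset.mul_sum]
    exact Finset.sum_congr rfl fun i _ => by ring
  have h3 : ∑ k', bpos D x.1 k' * xf q D ((k' : ℕ) + 1)
      = xf q D ((x.1 : ℕ) + 1) - (∑ k', adj D x.1 k' * xf q D ((k' : ℕ) + 1)) / 2 := by
    unfold bpos
    simp_rw [sub_mul, Finset.sum_sub_distrib, ite_mul, one_mul, zero_mul]
    rw [Finset.sum_ite_eq]
    simp only [Finset.mem_univ, if_true]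
    rw [Finset.sum_div]
    congr 1
    exact Finset.sum_congr rfl fun k' _ => by ring
  rw [h1, h2, h3]
  have ht := trow hq D x.1
  set S := ∑ k', adj D x.1 k' * xf q D ((k' : ℕ) + 1) with hSdef
  set X := xf q D ((x.1 : ℕ) + 1) with hXdef
  have hS : S = ((2 * (mult q : ℝ) + 1) * X - (if (x.1 : ℕ) = D then 1 else 0)) / (mult q : ℝ) := by
    field_simp; linarith [ht]
  rw [hS]
  unfold uSite
  rw [← hXdef]
  by_cases hk : (x.1 : ℕ) = D
  · have hiff : (x = (Fin.last D, i₀)) ↔ (x.2 = i₀) := by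
      constructor
      · intro h; rw [h]
      · intro h; exact Prod.ext (Fin.ext (by simp [hk])) h
    rw [if_pos hk, if_pos hk, if_congr hiff rfl rfl]
    split_ifs <;> field_simp <;> ring
  · have hne : x ≠ (Fin.last D, i₀) := fun h => hk (by rw [h]; simp)
    rw [if_neg hk, if_neg hk, if_neg hne]
    field_simp; ring

/-- A·col = e_{((D, i₀), c₀)} on the N-component index set. [folklore] -/
theorem opA_mulVec_col {q : ℕ} (hq : 1 ≤ q) (D N : ℕ) (i₀ : Fin (mult q)) (c₀ : Fin N) :
    opA D (mult q) N *ᵥ col q D N i₀ c₀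
      = Pi.single ((⟨(Fin.last D, i₀), Finset.mem_univ _⟩, c₀) : (chain D (mult q)).Idx Finset.univ N) 1 := by
  funext p
  simp only [Matrix.mulVec, dotProduct]
  unfold opA col
  rw [Pi.single_apply]
  by_cases hc : p.2 = c₀
  · have hterm : ∀ z : (chain D (mult q)).Idx Finset.univ N,
        (if p.2 = z.2 then aSite D (mult q) p.1.1 z.1.1 else 0) * (if z.2 = c₀ then uSite q D i₀ z.1.1 else 0)
          = if z.2 = c₀ then aSite D (mult q) p.1.1 z.1.1 * uSite q D i₀ z.1.1 else 0 := by
      intro z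
      by_cases hz : z.2 = c₀
      · rw [if_pos hz, if_pos (hc.trans hz.symm), if_pos hz]
      · rw [if_neg hz, mul_zero, if_neg hz]
    simp_rw [hterm]
    rw [Fintype.sum_prod_type]
    simp_rw [Finset.sum_ite_eq' Finset.univ c₀, if_pos (Finset.mem_univ _)]
    rw [Finset.sum_coe_sort Finset.univ (fun y : Site D (mult q) => aSite D (mult q) p.1.1 y * uSite q D i₀ y),
      aSite_col hq D i₀ p.1.1]
    refine if_congr ⟨fun h => ?_, fun h => ?_⟩ rfl rfl
    · exact Prod.ext (Subtype.ext h) hc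
    · rw [h]
  · rw [if_neg (fun h => hc (by rw [h]))]
    refine Finset.sum_eq_zero fun z _ => ?_
    by_cases hz : z.2 = c₀
    · rw [if_neg (fun h : p.2 = z.2 => hc (h.trans hz)), zero_mul]
    · rw [if_neg hz, mul_zero]

/-- the ENTRY of A⁻¹: A⁻¹(p, ((D,i₀),c₀)) = col(p) (A is invertible since A ≥ 1). [folklore] -/
theorem inv_entry {q : ℕ} (hq : 1 ≤ q) (D N : ℕ) (i₀ : Fin (mult q)) (c₀ : Fin N)
    (p : (chain D (mult q)).Idx Finset.univ N) :
    (opA D (mult q) N)⁻¹ p (⟨(Fin.last D, i₀), Finset.mem_univ _⟩, c₀) = col q D N i₀ c₀ p := by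
  have hdet : IsUnit (opA D (mult q) N).det :=
    B6BondElimination.isUnit_det_of_lower one_pos (opA_lower D (mult q) N)
  have h1 : (opA D (mult q) N)⁻¹ *ᵥ (opA D (mult q) N *ᵥ col q D N i₀ c₀) = col q D N i₀ c₀ := by
    rw [Matrix.mulVec_mulVec, Matrix.nonsing_inv_mul _ hdet, Matrix.one_mulVec]
  rw [opA_mulVec_col hq D N i₀ c₀] at h1
  have h2 := congrFun h1 p
  simp only [Matrix.mulVec, dotProduct, Pi.single_apply, mul_ite, mul_one, mul_zero, Finset.sum_ite_eq',
    Finset.mem_univ, if_true] at h2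
  exact h2

/-! ## §6  The class and the no-go theorem -/

/-- the CLASS of instances (frame, region): every chain {0,…,D} with m = q(q+1) zero-distance copies of each
position, q ≥ 1, region = all sites. [folklore] -/
def chainClass : (F : Frame) → Finset F.S → Prop :=
  fun F Ω => ∃ D q : ℕ, 1 ≤ q ∧ (⟨F, Ω⟩ : (F : Frame) × Finset F.S) = ⟨chain D (mult q), Finset.univ⟩

/-- every chain with m = q(q+1), q ≥ 1, is in the class. [folklore] -/
theorem chain_mem (D : ℕ) {q : ℕ} (hq : 1 ≤ q) : chainClass (chain D (mult q)) Finset.univ :=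
  ⟨D, q, hq, rfl⟩

/-- **NO-GO (kernel form of cell GAPS G-A19-1): the metric axioms of `Frame` do not imply an `Engine`.**  On the class
`chainClass` every operator `opA` satisfies (5.6)_ρ at the fixed constants (γ₀, c₀, δ₀) = (1, 3, 1) (`hyp56_opA`), yet
no pair (c₁, δ₁) gives (5.7)_ρ for all members: for m = q(q+1) with 1/q ≤ δ₁ the exact inverse entry between the two
ends of the chain of length D is ≥ 1/(m³·(1 + 1/q)^{D+2}), which beats c₁e^{−δ₁D} for D large because 1 + 1/q < e^{1/q}
≤ e^{δ₁}.  Hence `Engine N chainClass` is FALSE for every N ≥ 1 — an engine is a hypothesis PER CLASS (discharged by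
a uniform lattice-sum profile, `B6FrameReduction.engine_of_profile`; the chains have the m-dependent profile
m·Σ_k e^{−a|k|}, unbounded over the class).  A statement about the ABSTRACTION `B6FrameReduction.Engine` only —
[3] (Ω ⊂ ℤ^d, (5.6) ⇒ (5.7) p. 594) and B6 p. 242 concern honest lattices and are not disputed. [cite: Balaban1983RegularityDecay, (5.6)–(5.7) p.594; Balaban1984PropagatorsII, p.242] -/
theorem not_engine (N : ℕ) (hN : 1 ≤ N) : ¬ Engine N chainClass := by
  intro hE
  obtain ⟨c₁, δ₁, hc₁, hδ₁, h⟩ := hE 1 3 1 one_pos (by norm_num) one_pos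
  -- the multiplicity: q = ⌈1/δ₁⌉, m = q(q+1)
  set q : ℕ := ⌈δ₁⁻¹⌉₊ with hqdef
  have hq : 1 ≤ q := Nat.one_le_ceil_iff.mpr (inv_pos.mpr hδ₁)
  have hq0 : (0 : ℝ) < q := by exact_mod_cast hq
  have hqδ : (1 : ℝ) / q ≤ δ₁ := by
    rw [div_le_iff₀ hq0]
    have hle : δ₁⁻¹ ≤ q := Nat.le_ceil _
    calc (1 : ℝ) = δ₁ * δ₁⁻¹ := (mul_inv_cancel₀ hδ₁.ne').symm
      _ ≤ δ₁ * q := by gcongr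
  have hν : nu q = 1 + 1 / q := by unfold nu; field_simp
  have hν1 : 1 < nu q := nu_gt_one hq
  have hν0 : 0 < nu q := by linarith
  have hνe : nu q < Real.exp δ₁ := by
    rw [hν]
    have h1 : 1 / (q : ℝ) + 1 < Real.exp (1 / q) := Real.add_one_lt_exp (by positivity)
    have h2 : Real.exp (1 / (q : ℝ)) ≤ Real.exp δ₁ := Real.exp_le_exp.mpr hqδ
    linarith
  set r : ℝ := Real.exp δ₁ / nu q with hr
  have hr1 : 1 < r := (one_lt_div hν0).mpr hνe
  set M : ℝ := (mult q : ℝ) with hM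
  have hM0 : 0 < M := by rw [hM]; exact_mod_cast mult_pos hq
  -- the length: D with r^D > c₁ M³ ν²
  obtain ⟨n, hn⟩ := pow_unbounded_of_one_lt (c₁ * M ^ 3 * nu q ^ 2) hr1
  set D : ℕ := n + 1 with hD
  have hrD : c₁ * M ^ 3 * nu q ^ 2 < r ^ D := lt_of_lt_of_le hn (pow_le_pow_right₀ hr1.le (by omega))
  -- the instance and the two far indices
  have hm : 0 < mult q := mult_pos hq
  set i₀ : Fin (mult q) := ⟨0, hm⟩ with hi₀
  set c₀ : Fin N := ⟨0, hN⟩ with hc₀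
  set p₀ : (chain D (mult q)).Idx Finset.univ N := (⟨((0 : Fin (D + 1)), i₀), Finset.mem_univ _⟩, c₀) with hp₀
  set q₀ : (chain D (mult q)).Idx Finset.univ N := (⟨(Fin.last D, i₀), Finset.mem_univ _⟩, c₀) with hq₀
  have hID := h (chain D (mult q)) Finset.univ (chain_mem D hq) (opA D (mult q) N) (hyp56_opA D (mult q) N) p₀ q₀
  have hρ : (chain D (mult q)).ρ (p₀.1 : (chain D (mult q)).S) (q₀.1 : (chain D (mult q)).S) = D := by
    show cdist D (mult q) ((0 : Fin (D + 1)), i₀) (Fin.last D, i₀) = D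
    unfold cdist
    simp only [Fin.val_zero, Fin.val_last, Nat.cast_zero, zero_sub, abs_neg, Nat.abs_cast]
  rw [hρ, inv_entry hq D N i₀ c₀ p₀] at hID
  have hcol : col q D N i₀ c₀ p₀ = xf q D 1 / M := by
    show (if c₀ = c₀ then xf q D (((0 : Fin (D + 1)) : ℕ) + 1) / M
      + (if ((0 : Fin (D + 1)) : ℕ) = D then ((if i₀ = i₀ then 1 else 0) - 1 / (mult q : ℝ)) else 0) else 0)
      = xf q D 1 / M
    have hD0 : ¬ (((0 : Fin (D + 1)) : ℕ) = D) := by rw [Fin.val_zero]; omega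
    rw [if_pos rfl, if_neg hD0, add_zero, Fin.val_zero]
  rw [hcol] at hID
  -- the lower bound on the entry
  have hgap := gap_pos hq D
  have hgap' : nu q ^ (D + 2) - lam q ^ (D + 2) ≤ nu q ^ (D + 2) := by linarith [pow_pos (lam_pos hq) (D + 2)]
  have hdiff : 1 / M ≤ nu q - lam q := by
    have e : nu q - lam q = (2 * q + 1) / ((q : ℝ) * ((q : ℝ) + 1)) := by
      unfold nu lam; field_simp; ring
    rw [e, hM, mult_cast]
    exact div_le_div_of_nonneg_right (by linarith) (by positivity)
  have hx1 : xf q D 1 = (nu q - lam q) / (M * (nu q ^ (D + 2) - lam q ^ (D + 2))) := by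
    unfold xf; rw [pow_one, pow_one]
  have hlow : 1 / (M ^ 3 * nu q ^ (D + 2)) ≤ xf q D 1 / M := by
    rw [hx1]
    have hnl : 0 ≤ nu q - lam q := by have := one_div_pos.mpr hM0; linarith
    calc 1 / (M ^ 3 * nu q ^ (D + 2)) = (1 / M) / (M * nu q ^ (D + 2)) / M := by
          field_simp
      _ ≤ (nu q - lam q) / (M * nu q ^ (D + 2)) / M := by gcongr
      _ ≤ (nu q - lam q) / (M * (nu q ^ (D + 2) - lam q ^ (D + 2))) / M :=
          div_le_div_of_nonneg_right
            (div_le_div_of_nonneg_left hnl (mul_pos hM0 hgap) (mul_le_mul_of_nonneg_left hgap' hM0.le)) hM0.le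
  have hpos : 0 < xf q D 1 / M := lt_of_lt_of_le (by positivity) hlow
  rw [abs_of_pos hpos] at hID
  have key : 1 / (M ^ 3 * nu q ^ (D + 2)) ≤ c₁ * Real.exp (-(δ₁ * D)) := hlow.trans hID
  -- ⇒ r^D ≤ c₁ M³ ν², contradiction
  have hexpD : Real.exp (δ₁ * D) = Real.exp δ₁ ^ D := by
    rw [mul_comm]; exact Real.exp_nat_mul δ₁ D
  have hfin : r ^ D ≤ c₁ * M ^ 3 * nu q ^ 2 := by
    rw [hr, div_pow, ← hexpD, div_le_iff₀ (by positivity)]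
    rw [Real.exp_neg] at key
    have h1 : 0 < M ^ 3 * nu q ^ (D + 2) := by positivity
    have h2 : 0 < Real.exp (δ₁ * D) := Real.exp_pos _
    rw [div_le_iff₀ h1] at key
    calc Real.exp (δ₁ * D) = Real.exp (δ₁ * D) * 1 := (mul_one _).symm
      _ ≤ Real.exp (δ₁ * D) * (c₁ * (Real.exp (δ₁ * ↑D))⁻¹ * (M ^ 3 * nu q ^ (D + 2))) := by gcongr
      _ = c₁ * M ^ 3 * nu q ^ 2 * nu q ^ D := by
          field_simp
          ring
  linarith [hrD, hfin]

end

end Literature.MathematicalPhysics.QuantumFieldTheory.Balaban1983to89.B6FrameEngineScope
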